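import Mathlib
import Summits.ResolutionOfSingularities.ResolutionOfSingularities.Theorems.ShadowsUniformize.Negative.IdentityShadow
import HarnessLib

/-!
# The residue-constant map of a rational place and the CONSTANT exact arc (support for `stub_exactArcs`)

Support file for the crux `stmt-ResolutionOfSingularities-16757`
(`Summit.ResolutionOfSingularities.ResolutionOfSingularities.Theses.AbhyankarShadows.SemivaluationShadows`,
route `AbhyankarShadows`, line `birth`), open core `stub_exactArcs` (rational rank one, arc form).

* `exists_residueAlgHom` — at a RATIONAL place `O ∋ k` of `K/k` (every `x ∈ O` congruent to a
  constant), the constant is unique (`Theorems.ShadowsUniformize.Negative.residueConstant_unique`)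
  and `x ↦` its constant is a `k`-algebra homomorphism `R₁ →ₐ[k] k` on every `k`-subalgebra
  `R₁ ⊆ O`, with kernel the centre (`residueAlgHom_eq_zero_iff`).
* `exactArcDatum_of_valuation_eq_one` — the DEGENERATE case of the exact-arc datum of
  `stub_exactArcs`: if the finite set `F` contains no non-zero element of the centre (every non-zero
  `x ∈ F` has value `1`), the CONSTANT arc `α = (k ↪ k⟦t⟧) ∘ ψ` on a birational enlargement
  `R₁ ⊇ R` is an exact arc: it is centred (`α y ∈ (t) ↔ ν y < 1`), `ord α(y) = 0` whenever `α y ≠ 0`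
  (so `γ₀ ^ 0 = 1 = ν 1`), and it is exact on `F`. Any `γ₀` with `0 < γ₀ < 1` serves (one exists as
  soon as `O ≠ K`).

So the open content of `stub_exactArcs` is concentrated on finite sets meeting the centre.
[folklore]
-/

set_option linter.dupNamespace false -- mandated namespace of this single-conjunct summit

namespace Summit.ResolutionOfSingularities.ResolutionOfSingularities.Theorems

open Summit.ResolutionOfSingularities.ResolutionOfSingularities.Theorems.ShadowsUniformize.Negative
  (residueConstant_unique exists_fg_isFractionRing_le)

section ResidueHom

variable {k K : Type} [Field k] [Field K] [Algebra k K]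

/-- **The residue homomorphism of a rational place.** If every element of the valuation ring
`O ∋ k` of `K` is congruent to a constant modulo the maximal ideal, then on every `k`-subalgebra
`R₁ ⊆ O` there is a `k`-algebra homomorphism `ψ : R₁ →ₐ[k] k` with `ν (y - ψ y) < 1` for all `y`
(the constant is unique, `Theorems.ShadowsUniformize.Negative.residueConstant_unique`, which
makes `y ↦` its constant additive and multiplicative). Stated as an existence theorem so that no
definition is introduced. [folklore] -/
theorem exists_residueAlgHom (O : ValuationSubring K) (hk : ∀ c : k, algebraMap k K c ∈ O)
    (hrat : ∀ x : K, x ∈ O → ∃ c : k, O.valuation (x - algebraMap k K c) < 1)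
    (R₁ : Subalgebra k K) (h₁O : R₁.toSubring ≤ O.toSubring) :
    ∃ ψ : R₁ →ₐ[k] k, ∀ y : R₁, O.valuation ((y : K) - algebraMap k K (ψ y)) < 1 := by
  -- the residue constant and its characterisation
  let rc : R₁ → k := fun y => Classical.choose (hrat (y : K) (h₁O y.2))
  have hrc : ∀ y : R₁, O.valuation ((y : K) - algebraMap k K (rc y)) < 1 := fun y =>
    Classical.choose_spec (hrat (y : K) (h₁O y.2))
  have huniq : ∀ (y : R₁) (c : k), O.valuation ((y : K) - algebraMap k K c) < 1 → rc y = c :=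
    fun y c hc => residueConstant_unique O hk (hrc y) hc
  refine ⟨{ toFun := rc
            map_one' := huniq _ _ (by simp)
            map_mul' := fun y z => huniq _ _ ?_
            map_zero' := huniq _ _ (by simp)
            map_add' := fun y z => huniq _ _ ?_
            commutes' := fun c => huniq _ _ ?_ }, hrc⟩
  · have hrew : ((y * z : R₁) : K) - algebraMap k K (rc y * rc z) =
        (y : K) * ((z : K) - algebraMap k K (rc z)) +
          algebraMap k K (rc z) * ((y : K) - algebraMap k K (rc y)) := by
      rw [Subalgebra.coe_mul, map_mul]; ring
    rw [hrew]
    refine Valuation.map_add_lt _ ?_ ?_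
    · rw [map_mul]
      calc O.valuation (y : K) * O.valuation ((z : K) - algebraMap k K (rc z))
          ≤ 1 * O.valuation ((z : K) - algebraMap k K (rc z)) :=
            mul_le_mul_left ((O.valuation_le_one_iff _).mpr (h₁O y.2)) _
        _ < 1 := by rw [one_mul]; exact hrc z
    · rw [map_mul]
      calc O.valuation (algebraMap k K (rc z)) * O.valuation ((y : K) - algebraMap k K (rc y))
          ≤ 1 * O.valuation ((y : K) - algebraMap k K (rc y)) :=
            mul_le_mul_left ((O.valuation_le_one_iff _).mpr (hk (rc z))) _
        _ < 1 := by rw [one_mul]; exact hrc y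
  · have hrew : ((y + z : R₁) : K) - algebraMap k K (rc y + rc z) =
        ((y : K) - algebraMap k K (rc y)) + ((z : K) - algebraMap k K (rc z)) := by
      rw [Subalgebra.coe_add, map_add]; ring
    rw [hrew]
    exact Valuation.map_add_lt _ (hrc y) (hrc z)
  · have : ((algebraMap k R₁ c : R₁) : K) = algebraMap k K c := rfl
    rw [this, Algebra.algebraMap_self, RingHom.id_apply, sub_self, map_zero]
    exact zero_lt_one

/-- The residue homomorphism vanishes exactly on the centre. [folklore] -/
theorem residueAlgHom_eq_zero_iff (O : ValuationSubring K) (hk : ∀ c : k, algebraMap k K c ∈ O)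
    {R₁ : Subalgebra k K} (ψ : R₁ →ₐ[k] k)
    (hψ : ∀ y : R₁, O.valuation ((y : K) - algebraMap k K (ψ y)) < 1) (y : R₁) :
    ψ y = 0 ↔ O.valuation (y : K) < 1 := by
  constructor
  · intro h
    simpa [h] using hψ y
  · intro h
    refine residueConstant_unique O hk (hψ y) ?_
    simpa using h

end ResidueHom

/-- **A scale `0 < γ₀ < 1` exists at a non-trivial place.** [folklore] -/
theorem exists_valueGroup_pos_lt_one {K : Type} [Field K] (O : ValuationSubring K) (hO : O ≠ ⊤) :
    ∃ γ₀ : O.ValueGroup, 0 < γ₀ ∧ γ₀ < 1 := by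
  obtain ⟨z, hz⟩ : ∃ z : K, z ∉ O := by
    by_contra h
    push Not at h
    exact hO (ValuationSubring.ext _ _ fun w => ⟨fun _ => ValuationSubring.mem_top w, fun _ => h w⟩)
  have hz0 : z ≠ 0 := fun h0 => hz (h0 ▸ O.zero_mem)
  have hgt : 1 < O.valuation z := lt_of_not_ge fun hle => hz ((O.valuation_le_one_iff z).mp hle)
  refine ⟨O.valuation z⁻¹, ?_, ?_⟩
  · exact zero_lt_iff.mpr ((map_ne_zero O.valuation).mpr (inv_ne_zero hz0))
  · rw [map_inv₀]
    exact inv_lt_one_of_one_lt₀ hgt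

/-- **The constant exact arc** — the degenerate case of the exact-arc datum of `stub_exactArcs`:
if no non-zero element of the finite set `F ⊆ R` lies in the centre of the rational place `O`
(`ν x = 1` for the non-zero `x ∈ F`), then on a birational enlargement `R₁ ⊇ R` inside `O` the
constant arc `y ↦ (residue constant of y) ∈ k ⊆ k⟦t⟧` together with any `0 < γ₀ < 1` is an exact
arc: centred, `γ₀ ^ ord α(y) = 1 = ν 1` whenever `α y ≠ 0`, and exact on `F`. (Registered sub-goal
of the crux `SemivaluationShadows`; the remaining content of `stub_exactArcs` is for finite sets
meeting the centre.) [folklore] -/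
theorem exactArcDatum_of_valuation_eq_one : ∀ (k K : Type) [Field k] [Field K] [Algebra k K], (⊤ : IntermediateField k K).FG → ∀ (O : ValuationSubring K), (∀ c : k, algebraMap k K c ∈ O) → (∀ x : K, x ∈ O → ∃ c : k, O.valuation (x - algebraMap k K c) < 1) → O ≠ ⊤ → ∀ R : Subalgebra k K, R.FG → R.toSubring ≤ O.toSubring → ∀ F : Finset R, (∀ x ∈ F, ((x : R) : K) ≠ 0 → O.valuation ((x : R) : K) = 1) → ∃ (R₁ : Subalgebra k K) (hle : R ≤ R₁) (_ : R₁.toSubring ≤ O.toSubring), R₁.FG ∧ IsFractionRing R₁ K ∧ ∃ (α : R₁ →ₐ[k] PowerSeries k) (γ₀ : O.ValueGroup), 0 < γ₀ ∧ γ₀ < 1 ∧ (∀ y : R₁, PowerSeries.constantCoeff (α y) = 0 ↔ O.valuation (y : K) < 1) ∧ (∀ y : R₁, α y ≠ 0 → ∃ y' : R₁, γ₀ ^ (α y).order.toNat = O.valuation (y' : K)) ∧ ∀ x ∈ F, ((x : R) : K) ≠ 0 → α (Subalgebra.inclusion hle x) ≠ 0 ∧ γ₀ ^ (α (Subalgebra.inclusion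 hle x)).order.toNat = O.valuation ((x : R) : K) := by
  intro k K _ _ _ hKfg O hk hrat hO R hR hRO F hF
  obtain ⟨R₁, hle, h₁O, hfg₁, hfrac⟩ := exists_fg_isFractionRing_le hKfg O hk R hR hRO
  obtain ⟨γ₀, hγ₀, hγ₁⟩ := exists_valueGroup_pos_lt_one O hO
  obtain ⟨ψ, hψ⟩ := exists_residueAlgHom O hk hrat R₁ h₁O
  let α : R₁ →ₐ[k] PowerSeries k := (Algebra.ofId k (PowerSeries k)).comp ψ
  have hα : ∀ y : R₁, α y = PowerSeries.C (ψ y) := fun y => by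
    show algebraMap k (PowerSeries k) (ψ y) = _
    rw [PowerSeries.C_eq_algebraMap]
  -- order of a non-zero constant is `0`
  have hord : ∀ y : R₁, α y ≠ 0 → (α y).order.toNat = 0 := by
    intro y hy
    have hc : ψ y ≠ 0 := fun h => hy (by rw [hα, h, map_zero])
    rw [hα, ← PowerSeries.monomial_zero_eq_C_apply, PowerSeries.order_monomial_of_ne_zero 0 _ hc]
    rfl
  refine ⟨R₁, hle, h₁O, hfg₁, hfrac, α, γ₀, hγ₀, hγ₁, fun y => ?_, fun y hy => ⟨1, ?_⟩, fun x hx hx0 => ?_⟩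
  · rw [hα, PowerSeries.constantCoeff_C]
    exact residueAlgHom_eq_zero_iff O hk ψ hψ y
  · rw [hord y hy, pow_zero, Subalgebra.coe_one, map_one]
  · have hx1 : O.valuation ((Subalgebra.inclusion hle x : R₁) : K) = 1 := hF x hx hx0
    have hc : ψ (Subalgebra.inclusion hle x) ≠ 0 := by
      intro h
      have hlt := (residueAlgHom_eq_zero_iff O hk ψ hψ _).mp h
      rw [hx1] at hlt
      exact lt_irrefl _ hlt
    have hne : α (Subalgebra.inclusion hle x) ≠ 0 := by
      rw [hα]
      exact fun h => hc (PowerSeries.C_injective (by rw [h, map_zero]))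
    refine ⟨hne, ?_⟩
    rw [hord _ hne, pow_zero]
    exact hx1.symm

end Summit.ResolutionOfSingularities.ResolutionOfSingularities.Theorems
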